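import Summits.PneNP.PneNP.Theorems.ExpanderLinearGeneratorsColumnTwoFinalPrep
import Summits.PneNP.PneNP.Theorems.ExpanderLinearGeneratorsColumnTwoExpanderMinor
import Summits.PneNP.PneNP.Theorems.ExpanderLinearGeneratorsExpansionForcesDepthFregeSizeOfGaussianWidth

/-!
# PneNP / MatroidTseitin — `EvenHypergraphTseitinDepthFregeLB` at `k = 1` (Tseitin on
bounded-degree expander graphs), unconditionally

Route `PneNP/MatroidTseitin`, crux stmt-PneNP-11427
(`Summit.PneNP.PneNP.Theses.MatroidTseitin.EvenHypergraphTseitinDepthFregeLB`): for `k ≥ 1`, `Δ`,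
`d`, `c > 0` and large `n`, the vertex–hyperedge system of a `2k`-uniform hypergraph on `n`
vertices with degrees in `[4k, Δ]`, odd total charge and odd-cut expansion `c` up to `n/2` has no
depth-`d` `textbookFrege` refutation of size `< 2^{n^ε}`. Its case `k = 1` is Tseitin on
bounded-degree expander GRAPHS — Ben-Sasson's theorem (Comput. Complexity 2002), in print also via
Pitassi–Rossman–Servedio–Tan 2016 and Galesi–Itsykson–Riazanov–Sofronova 2019 — so far absent from
the tree. This file proves the case `k = 1` outright, by ROUTING (no switching lemma):

1. odd-cut expansion at rate `c` with degrees `≤ Δ` makes the row graph a GLOBAL vertex expander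
   of rate `1/⌈Δ/c⌉` (`card_le_mul_card_nbr`) and connected: the only closed nonempty row set
   is everything (`eq_univ_of_boundary_eq_empty`);
2. the weak-expander clique-minor engine `ColumnTwo.exists_clique_minor_fin`
   (Krivelevich–Sudakov with monotone death, `…ColumnTwoExpanderMinor`) gives a clique minor of
   polynomial order;
3. along it the sum-encoding projects onto the grid routing Tseitin system of the bijective
   pigeonhole principle (`ColumnTwo.exists_routing_subst`, `TextbookFrege.transfer_isDepthProofOf`),
   which is exponentially hard for bounded-depth Frege (`GridRouting.gridTseitin_depthFrege_lowerBound`).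

* `evenHypergraphTseitinDepthFregeLB_one` — the crux's body at `k = 1`;
* `evenHypergraphTseitinDepthFregeLB_iff_two_le` — hence the crux is equivalent to its restriction
  to `k ≥ 2` (the `2k`-uniform hypergraph case, unprinted).

References: E. Ben-Sasson, *Hard examples for the bounded depth Frege proof system*, Comput.
Complexity 11 (2002) 109–136; A. Urquhart, X. Fu, *Simplified lower bounds for propositional
proofs*, NDJFL 37 (1996); T. Pitassi, B. Rossman, R. Servedio, L.-Y. Tan, *Poly-logarithmic Frege
depth lower bounds via an expander switching lemma*, STOC 2016; M. Krivelevich, B. Sudakov,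
*Minors in expanding graphs*, GAFA 19 (2009).
-/

namespace Summit.PneNP.PneNP.Theorems.HypergraphTseitin

set_option linter.dupNamespace false -- `Summit.PneNP.PneNP.…`: summit = sub-problem (D-0017)

open Filter Finset Literature.Computability.MetaComplexity
open Literature.Computability.MetaComplexity.TextbookFrege
open Literature.Computability.Complexity (PropForm Clause CNF Literal)
open Literature.Computability.MetaComplexity.KrajicekRamsey (clauseOf)
open Summit.PneNP.PneNP.Theorems.GridRouting Summit.PneNP.PneNP.Theorems.ColumnTwo

variable {m n : ℕ}

/-! ### The row graph of a column-weight-two system -/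

/-- The cover degree of a variable (read in `ℕ`) is the number of rows of the set containing it.
[folklore] -/
theorem coverDegree_val (E : Fin m → LinEqMod 2 n) (W : Finset (Fin m)) (j : Fin n) :
    coverDegree (fun i => (E i).supp.map Fin.valEmbedding) W (j : ℕ) =
      (W.filter fun i => j ∈ (E i).supp).card := by
  unfold coverDegree
  congr 1
  exact Finset.filter_congr fun i _ => mem_map_val_iff

/-- **No cancellation beyond the boundary at column weight two**: the sum of the rows of `W`
is supported inside the boundary of `W` when every variable lies in at most two rows, so its
support is at most as large as the boundary. [folklore] -/
theorem card_supp_lincomb_le_card_boundary (E : Fin m → LinEqMod 2 n)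
    (hcol : ∀ j : Fin n, (Finset.univ.filter fun i => j ∈ (E i).supp).card ≤ 2)
    (W : Finset (Fin m)) :
    (lincomb (fun e => if e ∈ W then (1 : ZMod 2) else 0) E).supp.card ≤
      (boundary (fun i => (E i).supp.map Fin.valEmbedding) W).card := by
  refine Finset.card_le_card_of_injOn (fun j => (j : ℕ)) (fun j hj => ?_)
    (fun j₁ _ j₂ _ h => Fin.ext h)
  rw [Finset.mem_coe, mem_supp_iff_fst_ne_zero, fst_lincomb_indicator, sum_coeff_eq] at hj
  rw [Finset.mem_coe, mem_boundary_iff_coverDegree]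
  have h2 : coverDegree (fun i => (E i).supp.map Fin.valEmbedding) W (j : ℕ) ≤ 2 := by
    rw [coverDegree_val]
    exact (Finset.card_le_card (Finset.filter_subset_filter _ (Finset.subset_univ W))).trans
      (hcol j)
  set d := coverDegree (fun i => (E i).supp.map Fin.valEmbedding) W (j : ℕ) with hd
  rcases (show d = 0 ∨ d = 1 ∨ d = 2 by omega) with h | h | h
  · rw [h] at hj; exact absurd hj (by simp)
  · exact h
  · rw [h] at hj; exact absurd hj (by decide)

section RowGraph

variable (E : Fin m → LinEqMod 2 n)
  (hcol2 : ∀ j : Fin n, (Finset.univ.filter fun i => j ∈ (E i).supp).card = 2)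
include hcol2

/-- At column weight exactly two the whole row set is closed (has empty boundary). [folklore] -/
theorem boundary_univ_eq_empty :
    boundary (fun i => (E i).supp.map Fin.valEmbedding) Finset.univ = ∅ := by
  rw [Finset.eq_empty_iff_forall_notMem]
  intro v hv
  have h1 := mem_boundary_iff_coverDegree.1 hv
  obtain ⟨i, -, hvi⟩ := mem_cover.1 (boundary_subset_cover _ hv)
  obtain ⟨j, -, rfl⟩ := Finset.mem_map.1 hvi
  change coverDegree (fun i => (E i).supp.map Fin.valEmbedding) Finset.univ ((j : Fin n) : ℕ) = 1
    at h1
  rw [coverDegree_val, hcol2 j] at h1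
  exact absurd h1 (by norm_num)

/-- **Odd-cut expansion makes the row graph a global vertex expander**: with degrees `≤ Δ`,
every variable in exactly two rows and `c|W| ≤ |supp Σ_{i∈W} E_i|` for `2|W| ≤ m`, every such
`W` has `|W| ≤ b |nbr W|` as soon as `Δ/c ≤ b`. [folklore] -/
theorem card_le_mul_card_nbr {Δ b : ℕ} {c : ℝ} (hΔ : ∀ i, (E i).supp.card ≤ Δ) (hc : 0 < c)
    (hoc : ∀ W : Finset (Fin m), 2 * W.card ≤ m →
      c * (W.card : ℝ) ≤ ((lincomb (fun i => if i ∈ W then (1 : ZMod 2) else 0) E).supp.card : ℝ))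
    (hb : (Δ : ℝ) / c ≤ b) (W : Finset (Fin m)) (hW : 2 * W.card ≤ m) :
    W.card ≤ b * (nbr (fun i => (E i).supp.map Fin.valEmbedding) Finset.univ W).card := by
  set S : Fin m → Finset ℕ := fun i => (E i).supp.map Fin.valEmbedding with hS
  have hcw : ∀ v, coverDegree S Finset.univ v ≤ 2 := coverDegree_le_two_of_col E fun j => (hcol2 j).le
  have hℓ : ∀ i, (S i).card ≤ Δ := fun i => by simp only [hS, Finset.card_map]; exact hΔ i
  have h1 := hoc W hW
  have h2 := card_supp_lincomb_le_card_boundary E (fun j => (hcol2 j).le) W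
  have h3 : (boundary S W).card ≤ Δ * (nbr S Finset.univ W).card := by
    calc (boundary S W).card ≤ (cut S Finset.univ W ∪ boundary S Finset.univ).card :=
          Finset.card_le_card (boundary_subset_cut_union hcw (Finset.subset_univ W))
      _ = (cut S Finset.univ W).card := by rw [boundary_univ_eq_empty E hcol2, Finset.union_empty]
      _ ≤ Δ * (nbr S Finset.univ W).card := card_cut_le hℓ _ _
  have h4 : c * (W.card : ℝ) ≤ Δ * ((nbr S Finset.univ W).card : ℝ) := by
    calc c * (W.card : ℝ) ≤ ((boundary S W).card : ℝ) := h1.trans (by exact_mod_cast h2)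
      _ ≤ _ := by exact_mod_cast h3
  have h5 : (W.card : ℝ) ≤ b * ((nbr S Finset.univ W).card : ℝ) := by
    have h6 : (W.card : ℝ) ≤ (Δ : ℝ) / c * ((nbr S Finset.univ W).card : ℝ) := by
      rw [div_mul_eq_mul_div, le_div_iff₀ hc]; linarith
    exact h6.trans (mul_le_mul_of_nonneg_right hb (Nat.cast_nonneg _))
  exact_mod_cast h5

/-- **Connectedness**: under odd-cut expansion at a positive rate, a nonempty closed row set is
the whole row set. [folklore] -/
theorem eq_univ_of_boundary_eq_empty {c : ℝ} (hc : 0 < c)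
    (hoc : ∀ W : Finset (Fin m), 2 * W.card ≤ m →
      c * (W.card : ℝ) ≤ ((lincomb (fun i => if i ∈ W then (1 : ZMod 2) else 0) E).supp.card : ℝ))
    {K : Finset (Fin m)} (hKne : K.Nonempty)
    (hKb : boundary (fun i => (E i).supp.map Fin.valEmbedding) K = ∅) : K = Finset.univ := by
  set S : Fin m → Finset ℕ := fun i => (E i).supp.map Fin.valEmbedding with hS
  have hcol : ∀ j : Fin n, (Finset.univ.filter fun i => j ∈ (E i).supp).card ≤ 2 :=
    fun j => (hcol2 j).le
  have hcw : ∀ v, coverDegree S Finset.univ v ≤ 2 := coverDegree_le_two_of_col E hcol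
  -- a row set with empty boundary and at most half the rows is empty
  have key : ∀ W : Finset (Fin m), 2 * W.card ≤ m → boundary S W = ∅ → W = ∅ := by
    intro W hW hWb
    have h1 := hoc W hW
    have h2 := card_supp_lincomb_le_card_boundary E hcol W
    rw [show boundary (fun i => (E i).supp.map Fin.valEmbedding) W = boundary S W from rfl, hWb,
      Finset.card_empty, Nat.le_zero, Finset.card_eq_zero] at h2
    rw [h2, Finset.card_empty, Nat.cast_zero] at h1
    have h3 : (W.card : ℝ) ≤ 0 := by nlinarith
    exact Finset.card_eq_zero.1 (Nat.le_zero.1 (by exact_mod_cast h3))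
  by_contra hK
  by_cases h2K : 2 * K.card ≤ m
  · exact hKne.ne_empty (key K h2K hKb)
  · -- the complement is small, closed and nonempty
    set K' := Finset.univ \ K with hK'
    have hK'card : K'.card = m - K.card := by
      rw [hK', Finset.card_sdiff_of_subset (Finset.subset_univ K), Finset.card_univ, Fintype.card_fin]
    have hKm : K.card ≤ m := (Finset.card_le_univ K).trans (by simp)
    have hK'ne : K'.Nonempty := by
      rw [Finset.nonempty_iff_ne_empty]
      intro h
      apply hK
      rw [hK', Finset.sdiff_eq_empty_iff_subset] at h
      exact Finset.Subset.antisymm (Finset.subset_univ K) h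
    have hcut : cut S Finset.univ K' = ∅ := by
      rw [Finset.eq_empty_iff_forall_notMem]
      intro v hv
      simp only [ColumnTwo.cut, Finset.mem_filter] at hv
      have h1 : Finset.univ \ K' = K := by rw [hK', Finset.sdiff_sdiff_eq_self (Finset.subset_univ K)]
      rw [h1] at hv
      have : v ∈ boundary S K := mem_boundary_iff_coverDegree.2 hv.2
      rw [show boundary S K = boundary (fun i => (E i).supp.map Fin.valEmbedding) K from rfl, hKb] at this
      exact Finset.notMem_empty v this
    have hK'b : boundary S K' = ∅ := by
      have := boundary_subset_cut_union hcw (Finset.subset_univ K')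
      rw [hcut, boundary_univ_eq_empty E hcol2, Finset.empty_union] at this
      exact Finset.subset_empty.1 this
    exact hK'ne.ne_empty (key K' (by omega) hK'b)

end RowGraph

/-! ### The case `k = 1` of the crux -/

/-- **`EvenHypergraphTseitinDepthFregeLB` at `k = 1`, unconditionally (Ben-Sasson's theorem:
Tseitin on bounded-degree expanders is hard for bounded-depth Frege).** For every `Δ`, depth `d`
and `c > 0` there are `ε > 0` and `N` such that for `n ≥ N`: if `E` is the vertex–edge system of a
graph on `n` vertices (every column of weight exactly `2`) with degrees in `[4, Δ]`, odd total
charge `Σ b_v = 1`, and odd-cut expansion (`c|S| ≤ |supp Σ_{i ∈ S} E_i|` whenever `2|S| ≤ n`),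
then every depth-`d` `textbookFrege` proof of `¬(sumEncoding 1 E)` has size `≥ 2^(n^ε)`. This is
the body of `Summit.PneNP.PneNP.Theses.MatroidTseitin.EvenHypergraphTseitinDepthFregeLB` with
`k := 1`, proved by routing the grid Tseitin system of the bijective pigeonhole principle along a
Krivelevich–Sudakov clique minor of the expander (no switching lemma).
[Ben-Sasson 2002, Thm. 1.1 (qualitative form); Urquhart–Fu 1996; Krivelevich–Sudakov 2009] -/
theorem evenHypergraphTseitinDepthFregeLB_one :
    ∀ (Δ d : ℕ) (c : ℝ), 0 < c → ∃ ε : ℝ, 0 < ε ∧ ∃ N : ℕ, ∀ n ≥ N,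
      ∀ (v : ℕ) (E : Fin n → LinEqMod 2 v),
      (∀ i, 4 * 1 ≤ (E i).supp.card ∧ (E i).supp.card ≤ Δ) →
      (∀ j : Fin v, (Finset.univ.filter fun i => (E i).1 j ≠ 0).card = 2 * 1) →
      ∑ i, (E i).2 = 1 →
      (∀ S : Finset (Fin n), 2 * S.card ≤ n →
        c * (S.card : ℝ) ≤ ((lincomb (fun i => if i ∈ S then (1 : ZMod 2) else 0) E).supp.card : ℝ)) →
      ∀ π : List (PropForm ℕ),
        textbookFrege.IsDepthProofOf d π (PropForm.neg (PropForm.ofCNF (sumEncoding 1 E))) →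
          (2 : ℝ) ^ ((n : ℝ) ^ ε) ≤ (proofSize π : ℝ) := by
  intro Δ d c hc
  -- the rate `1/b` of vertex expansion and the constant of the budget
  set b : ℕ := ⌈(Δ : ℝ) / c⌉₊ + 1 with hb
  have hb1 : 1 ≤ b := by omega
  have hbc : (Δ : ℝ) / c ≤ b := by
    rw [hb]; push_cast; linarith [Nat.le_ceil ((Δ : ℝ) / c)]
  set Cb : ℕ := 320 * b ^ 2 * (1 + b) ^ 2 * (1 + 2 * b) with hCb
  obtain ⟨ε₀, hε₀, K₁, hK₁⟩ := gridTseitin_depthFrege_lowerBound (d + 3 * 4 + 16)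
  obtain ⟨N, hN⟩ := eventually_atTop.1
    ((eventually_params one_pos le_rfl hε₀ K₁ transferConst).and (eventually_ge_atTop (2 ^ Cb)))
  refine ⟨1 * ε₀ / 10, by positivity, N, ?_⟩
  intro n hn v E hdeg hcol2 _ hoc π hπ
  obtain ⟨⟨hn3, hvol0, hK₁k, h227, hT3, hk4, -⟩, hnC⟩ := hN n hn
  classical
  -- parameters
  set kg : ℕ := ⌊(n : ℝ) ^ ((1 : ℝ) / 5)⌋₊ with hkg
  set Λ : ℕ := Nat.log 2 (2 * n) + 1 with hΛ
  set M : ℕ := nRows kg with hM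
  obtain ⟨h, hh⟩ : ∃ h : ℕ, h = (1 + b) * M := ⟨_, rfl⟩
  obtain ⟨t₁, ht₁⟩ : ∃ t : ℕ, t = 2 * b * Λ := ⟨_, rfl⟩
  obtain ⟨ℓ, hℓ⟩ : ∃ l : ℕ, l = 1 + h * (2 * (t₁ + 6 * b) + 2) := ⟨_, rfl⟩
  set S : Fin n → Finset ℕ := fun i => (E i).supp.map Fin.valEmbedding with hS
  -- basic facts
  have hfloor1 : ⌊(n : ℝ) ^ (1 : ℝ)⌋₊ = n := by rw [Real.rpow_one, Nat.floor_natCast]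
  rw [hfloor1] at hvol0
  have hnΛ : n < 2 ^ Λ := lt_of_le_of_lt (by omega) (Nat.lt_pow_succ_log_self one_lt_two (2 * n))
  have hΛ1 : 1 ≤ Λ := by rw [hΛ]; omega
  have hCΛ : Cb ≤ Λ := by
    rw [hΛ]
    have h1 : Cb ≤ Nat.log 2 n := Nat.le_log_of_pow_le one_lt_two hnC
    have h2 : Nat.log 2 n ≤ Nat.log 2 (2 * n) := Nat.log_mono_right (by omega)
    omega
  have hM1 : 1 ≤ M := (nRows_bounds kg).2.2.2.1
  have hMk : M ≤ (kg + 3) ^ 2 := (nRows_bounds kg).1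
  -- the column hypothesis in the form of the routing pipeline
  have hcol2' : ∀ j : Fin v, (Finset.univ.filter fun i => j ∈ (E i).supp).card = 2 := by
    intro j
    have h1 := hcol2 j
    rw [mul_one] at h1
    have h2 : (Finset.univ.filter fun i => j ∈ (E i).supp) =
        Finset.univ.filter fun i => (E i).1 j ≠ 0 := by
      ext i
      simp only [Finset.mem_filter, mem_supp_iff_fst_ne_zero]
    rw [h2]
    exact h1
  have hcol : ∀ j : Fin v, (Finset.univ.filter fun i => j ∈ (E i).supp).card ≤ 2 :=
    fun j => (hcol2' j).le
  have hΔ : ∀ i, (E i).supp.card ≤ Δ := fun i => (hdeg i).2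
  -- global vertex expansion of the row graph
  have hexp : ∀ W ⊆ (Finset.univ : Finset (Fin n)), 2 * W.card ≤ n →
      1 * W.card ≤ b * (nbr S Finset.univ W).card := fun W _ hW => by
    rw [one_mul]; exact card_le_mul_card_nbr E hcol2' hΔ hc hoc hbc W hW
  -- the budget of the clique-minor engine
  have hℓb : ℓ ≤ 20 * b * (1 + b) * (kg + 3) ^ 2 * Λ := by
    have e1 : 1 * 1 ≤ b * Λ := Nat.mul_le_mul hb1 hΛ1
    have e2 : b ≤ b * Λ := Nat.le_mul_of_pos_right b hΛ1
    have h1 : 2 * (t₁ + 6 * b) + 2 ≤ 18 * b * Λ := by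
      rw [ht₁]
      calc 2 * (2 * b * Λ + 6 * b) + 2 = 4 * (b * Λ) + 12 * b + 2 := by ring
        _ ≤ 18 * (b * Λ) := by omega
        _ = 18 * b * Λ := by ring
    have h2 : h ≤ (1 + b) * (kg + 3) ^ 2 :=
      calc h = (1 + b) * M := hh
        _ ≤ (1 + b) * (kg + 3) ^ 2 := Nat.mul_le_mul (le_refl _) hMk
    have hy : 0 < b * (1 + b) * (kg + 3) ^ 2 * Λ :=
      Nat.mul_pos (Nat.mul_pos (Nat.mul_pos (by omega) (by omega)) (by positivity)) (by omega)
    calc ℓ = 1 + h * (2 * (t₁ + 6 * b) + 2) := hℓ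
      _ ≤ 1 + ((1 + b) * (kg + 3) ^ 2) * (18 * b * Λ) := by gcongr
      _ = 1 + 18 * (b * (1 + b) * (kg + 3) ^ 2 * Λ) := by ring
      _ ≤ 20 * (b * (1 + b) * (kg + 3) ^ 2 * Λ) := by omega
      _ = 20 * b * (1 + b) * (kg + 3) ^ 2 * Λ := by ring
  have hbud : 16 * b * (h * ℓ) * (1 + 2 * b) ≤ 1 * 1 * n := by
    calc 16 * b * (h * ℓ) * (1 + 2 * b) = (16 * b * (1 + 2 * b) * h) * ℓ := by ring
      _ ≤ (16 * b * (1 + 2 * b) * ((1 + b) * (kg + 3) ^ 2)) *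
            (20 * b * (1 + b) * (kg + 3) ^ 2 * Λ) := by
          gcongr
          calc h = (1 + b) * M := hh
            _ ≤ (1 + b) * (kg + 3) ^ 2 := Nat.mul_le_mul (le_refl _) hMk
      _ = Cb * ((kg + 3) ^ 4 * Λ) := by rw [hCb]; ring
      _ ≤ Λ * ((kg + 3) ^ 4 * Λ) := Nat.mul_le_mul_right _ hCΛ
      _ = Λ ^ 2 * (kg + 3) ^ 4 := by ring
      _ ≤ Λ ^ 5 * (kg + 3) ^ 4 := Nat.mul_le_mul_right _ (Nat.pow_le_pow_right hΛ1 (by norm_num))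
      _ ≤ 10 ^ 11 * Λ ^ 5 * (kg + 3) ^ 4 := by
          rw [mul_assoc]; exact Nat.le_mul_of_pos_left _ (by norm_num)
      _ ≤ n := hvol0
      _ = 1 * 1 * n := by ring
  -- the clique minor
  have ht₁' : (2 * b) ^ t₁ * n < (2 * b + 1) ^ t₁ := by rw [ht₁]; exact linking_radius hb1 hnΛ
  obtain ⟨T, hT1, hT2⟩ := exists_clique_minor_fin (S := S) (U := Finset.univ) (N := n) (a := 1)
    (b := b) (h := h) (ℓ := ℓ) (t₁ := t₁) (by simp) le_rfl hb1 hb1 hexp ht₁' (by rw [hℓ]) hbud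
    (M := M) (by rw [hh, one_mul])
  -- the embedding data for the routing
  have hemb : ∀ K : Finset (Fin n), K.Nonempty → IsConn S K → boundary S K = ∅ →
      ∑ i ∈ K, (E i).2 = 1 → ∃ T : Fin M → Finset (Fin n),
        (∀ a, T a ⊆ K ∧ IsConn S (T a) ∧ (T a).Nonempty) ∧ (∀ a b, a ≠ b → Disjoint (T a) (T b)) ∧
        (∀ a b, a ≠ b → ((gridSystem kg a).supp ∩ (gridSystem kg b).supp).Nonempty →
          ∃ i ∈ T a, ∃ j ∈ T b, (S i ∩ S j).Nonempty) := by
    intro K hKne _ hKb _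
    have hK : K = Finset.univ := eq_univ_of_boundary_eq_empty E hcol2' hc hoc hKne hKb
    subst hK
    refine ⟨T, fun a => ⟨Finset.subset_univ _, (hT1 a).2.1, ?_⟩, fun a b hab => (hT2 a b hab).1,
      fun a b hab _ => (hT2 a b hab).2⟩
    rw [← Finset.card_pos, (hT1 a).2.2, hℓ]; omega
  -- the routing substitution and the transfer
  obtain ⟨σ, hZ, hT, hloc⟩ := exists_routing_subst E (gridSystem kg) (k₀ := 4) hcol
    (card_filter_mem_supp_gridSystem (k := kg)) (card_supp_gridSystem_le kg) (sum_gridSystem_snd kg) hemb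
  obtain ⟨π', hπ', hsize⟩ := transfer_isDepthProofOf (sumEncoding 1 E) (sumEncoding 1 (gridSystem kg))
    σ (Zσ := 9 * 2 ^ 4) (Tσ := 3 * 4) (qq := 2 ^ 4) (k := 4) hZ (by norm_num) hT hπ hloc
  -- the grid lower bound
  have hlb := hK₁ kg hK₁k π' hπ'
  -- the size of the transferred proof
  have hms := msum_gridClauses_le (k := kg)
  have hsz : proofSize π' ≤ transferConst * (144 * proofSize π + 224 * M + 3) ^ 3 := by
    refine hsize.trans ?_
    have h1 : transferLines (proofSize π) (proofSize π * (9 * 2 ^ 4) +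
        msum ((sumEncoding 1 (gridSystem kg)).map clauseOf)) (2 ^ 4) 4 ≤
        transferLines (144 * proofSize π) (144 * proofSize π + 224 * M) 16 4 := by
      rw [show (2 ^ 4 : ℕ) = 16 by norm_num]
      exact transferLines_mono (by omega) (by omega)
    have h2 : 40 * ((2 ^ 4 + 3) * (proofSize π * (9 * 2 ^ 4) +
        msum ((sumEncoding 1 (gridSystem kg)).map clauseOf) + 3) + 4) + 300 ≤
        40 * (19 * (144 * proofSize π + 224 * M + 3) + 4) + 300 := by
      norm_num
      omega
    exact (Nat.mul_le_mul h1 h2).trans (transferBound_le' (144 * proofSize π) M)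
  -- conclude
  have hMn : M ≤ n := by
    have h2 : (kg + 3) ^ 2 ≤ (kg + 3) ^ 4 := Nat.pow_le_pow_right (by omega) (by norm_num)
    have hpos : 0 < 10 ^ 11 * Λ ^ 5 := Nat.mul_pos (Nat.pow_pos (by norm_num)) (Nat.pow_pos (by omega))
    have h3 : (kg + 3) ^ 4 ≤ 10 ^ 11 * Λ ^ 5 * (kg + 3) ^ 4 := Nat.le_mul_of_pos_left _ hpos
    omega
  have hT0 : 0 < transferConst := by unfold transferConst; omega
  exact lb_arith hT0 hlb hsz hMn (by omega) h227 hT3 hk4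

/-- **The crux is its own case `k ≥ 2`.** `EvenHypergraphTseitinDepthFregeLB` is equivalent to
its restriction to `k ≥ 2` (the `2k`-uniform HYPERGRAPH rungs, unprinted), the graph case `k = 1`
being `evenHypergraphTseitinDepthFregeLB_one`. [Ben-Sasson 2002 (the case `k = 1`)] -/
theorem evenHypergraphTseitinDepthFregeLB_iff_two_le :
    Summit.PneNP.PneNP.Theses.MatroidTseitin.EvenHypergraphTseitinDepthFregeLB ↔
    ∀ (k Δ d : ℕ) (c : ℝ), 2 ≤ k → 0 < c → ∃ ε : ℝ, 0 < ε ∧ ∃ N : ℕ, ∀ n ≥ N,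
      ∀ (v : ℕ) (E : Fin n → LinEqMod 2 v),
      (∀ i, 4 * k ≤ (E i).supp.card ∧ (E i).supp.card ≤ Δ) →
      (∀ j : Fin v, (Finset.univ.filter fun i => (E i).1 j ≠ 0).card = 2 * k) →
      ∑ i, (E i).2 = 1 →
      (∀ S : Finset (Fin n), 2 * S.card ≤ n →
        c * (S.card : ℝ) ≤ ((lincomb (fun i => if i ∈ S then (1 : ZMod 2) else 0) E).supp.card : ℝ)) →
      ∀ π : List (PropForm ℕ),
        textbookFrege.IsDepthProofOf d π (PropForm.neg (PropForm.ofCNF (sumEncoding 1 E))) →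
          (2 : ℝ) ^ ((n : ℝ) ^ ε) ≤ (proofSize π : ℝ) := by
  constructor
  · intro H k Δ d c hk hc
    exact H k Δ d c (by omega) hc
  · intro H k Δ d c hk hc
    rcases Nat.lt_or_ge k 2 with hk2 | hk2
    · obtain rfl : k = 1 := by omega
      exact evenHypergraphTseitinDepthFregeLB_one Δ d c hc
    · exact H k Δ d c hk2 hc

end Summit.PneNP.PneNP.Theorems.HypergraphTseitin
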